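import Summits.QuantumFields.BalabanUV.T4Continuum.Support.NE7LocalLandauLetters
import HarnessLib

/-!
# NE7LocalLandauGradientLetter — THE CONDITIONAL LOCAL GRADIENT LETTER AND THE LOCAL LAPLACIAN LETTER OF A LANDAU REPRESENTATIVE ON A CUBE (companion of G1
# `NE7LocalLandauLetters`): for `x₀` with `{|y − x₀|_∞ ≤ R + 3}` inside the gauged cube and `G` bounding `∇A` on `{|y − x₀|_∞ ≤ R + 1}`,
# `‖A(x₀+e_τ)_κ − A(x₀)_κ‖ ≤ 2(d·a₀∕R + R·((j + d(εb₀(2+b₀) + 2ε²(2+ε)) + 4d(e^{4a₀}−1)G) + 2d(e^{a₀}−1)G))` (`b₀ = e^{a₀} − 1`) — the input shape of G2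
# `NE7WeightedGradientBootstrap` — and `‖ΔA_ν(y)‖ ≤ (same bracket)` on `{|y − x₀|_∞ ≤ R}` (file G1b of gen 112's BOX ROUTE to [Balaban1985Variational] Thm 1 (9)∕(10))

Cell `pub-balaban`, rung (B)+1 sub-cell t4, lineage `b2b-balaban-t4-ne7-p1` (CRUX PROVER NE7 #1 = OWNER of BINDER row NE7), generation 112.  Memo
`t4/b2b-balaban-t4-ne7-p1-g112/ROAD-G112.md` §5.  Over G1's local clones and (156) `NE7LatticeHodgeGradient.norm_fdiff_le_of_curl_div` ∕ `laplacian_eq_sum_dCurl_add_dDiv`.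
THE SETTING.  `W : ℤᵈ → (Fin d → U(n))` (in use `W = U^{u}`: `SmallField W ε`, `‖covDiv 1 W‖ = ‖covDiv 1 U‖ ≤ j`), a bond field `A` with `W = expUnit A`, `‖A‖ ≤ a₀` and the
`sinh`-Landau condition on the cube `{|z − c|_∞ ≤ S}` (gen 93's `NE7CubeLandauChart.cube_landau_chart` delivers exactly this on a cube about any point).
WHAT ([folklore]; 0 def, 0 sorry).  `local_curl_div_bounds` ((J) curl-divergence and (P) reaction-gradient bounds at every `y` with `|y − x₀|_∞ ≤ R`), **`local_gradient_letter`**,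
**`local_laplacian_letter`**.
HONEST FRAMING (page 1): lattice bookkeeping at ONE configuration; `a₀`, `G`, `j` HYPOTHESES; nothing of Bałaban's asserted; nothing about minimisers; NOT NE3∕NE7 as spine nodes;
spine 0∕9; finite T⁴ rung (B)+1 — NOT infinite volume, NOT mass gap, NOT BetaPertH, NOT Clay (continuum YM on T⁴ ⇐ BetaPertH ∧ nine spine estimates).
-/

set_option autoImplicit false

open NormedSpace
open scoped BigOperators Matrix Matrix.Norms.L2Operator
open Finset

namespace Summit.QuantumFields.BalabanUV.T4Continuum.NE7LocalLandauGradientLetter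

open Literature.MathematicalPhysics.QuantumFieldTheory.Balaban1983to89
open B7Prop1Explicit B7Prop2Explicit
open B8Ineq132 (covDiv)
open T4AveragingDeficitWall (SmallField)
open NE7LatticeHodgeGradient (laplacian_eq_sum_dCurl_add_dDiv norm_fdiff_le_of_curl_div)
open NE7GradientCurrencyCovariant (norm_expUnit_sub_one_le')
open NE7LocalLandauLetters

noncomputable section

variable {d : ℕ} {n : Type*} [Fintype n] [DecidableEq n] [Nonempty n]

/-! ## §2 The conditional local letters on a cube -/

section Local

variable (W : Site d → Fin d → (Matrix n n ℂ)ˣ) (A : Site d → Fin d → Matrix n n ℂ) (c : Site d) (S : ℤ) {ε a₀ j : ℝ}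

/-- **THE LOCAL CURL-DIVERGENCE AND REACTION-GRADIENT BOUNDS.**  Setting of the module docstring (`W = expUnit A`, `‖A‖ ≤ a₀` and the `sinh`-Landau condition on the cube
`{|z − c|_∞ ≤ S}`; `SmallField W ε`; `‖covDiv 1 W‖ ≤ j`).  For `x₀`, `R` with `{|y − x₀|_∞ ≤ R + 3} ⊆ {|y − c|_∞ ≤ S}` and `G` bounding the forward differences of `A`
based in `{|y − x₀|_∞ ≤ R + 1}`: at every `y` with `|y − x₀|_∞ ≤ R` and every `ν`,
(J) `‖Σ_μ [dA(y;μ,ν) − dA(y−e_μ;μ,ν)]‖ ≤ (j + d(ε·b₀(2+b₀) + 2ε²(2+ε))) + 4d(e^{4a₀}−1)G` (`b₀ = e^{a₀} − 1`), and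
(P) `‖div A(y+e_ν) − div A(y)‖ ≤ 2d(e^{a₀}−1)G`. [folklore] -/
theorem local_curl_div_bounds (hε0 : 0 ≤ ε) (ha₀0 : 0 ≤ a₀) (hWε : SmallField W ε) (hcov : ∀ (ν : Fin d) (z : Site d), ‖covDiv 1 W ν z‖ ≤ j)
    (hWexp : ∀ z : Site d, (∀ i, |z i - c i| ≤ S) → ∀ κ : Fin d, W z κ = expUnit (A z κ))
    (hA : ∀ z : Site d, (∀ i, |z i - c i| ≤ S) → ∀ κ : Fin d, ‖A z κ‖ ≤ a₀)
    (hEL : ∀ z : Site d, (∀ i, |z i - c i| ≤ S) →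
      ∑ κ : Fin d, (((2 : ℂ)⁻¹ • (exp (A z κ) - exp (-A z κ))) - ((2 : ℂ)⁻¹ • (exp (A (z - e κ) κ) - exp (-A (z - e κ) κ)))) = 0)
    (x₀ : Site d) (R : ℕ) (hfit : ∀ y : Site d, (∀ i, |y i - x₀ i| ≤ (R : ℤ) + 3) → ∀ i, |y i - c i| ≤ S)
    {G : ℝ} (hG : ∀ y : Site d, (∀ i, |y i - x₀ i| ≤ (R : ℤ) + 1) → ∀ κ τ : Fin d, ‖A (y + e τ) κ - A y κ‖ ≤ G) :
    (∀ y : Site d, (∀ i, |y i - x₀ i| ≤ (R : ℤ)) → ∀ ν : Fin d,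
      ‖∑ μ, ((A y μ + A (y + e μ) ν - A (y + e ν) μ - A y ν)
              - (A (y - e μ) μ + A (y - e μ + e μ) ν - A (y - e μ + e ν) μ - A (y - e μ) ν))‖
        ≤ (j + d * (ε * (Real.exp a₀ - 1) * (2 + (Real.exp a₀ - 1)) + 2 * ε * ε * (2 + ε))) + 4 * d * (Real.exp (4 * a₀) - 1) * G) ∧
    (∀ y : Site d, (∀ i, |y i - x₀ i| ≤ (R : ℤ)) → ∀ ν : Fin d,
      ‖∑ μ, (A (y + e ν) μ - A (y + e ν - e μ) μ) - ∑ μ, (A y μ - A (y - e μ) μ)‖ ≤ 2 * d * (Real.exp a₀ - 1) * G) := by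
  -- every point within `1` of a `y` with `|y − x₀|_∞ ≤ R` is within `R + 1` of `x₀`, hence in the cube
  have hnear : ∀ y : Site d, (∀ i, |y i - x₀ i| ≤ (R : ℤ)) → ∀ z : Site d, (∀ i, |z i - y i| ≤ 1) → ∀ i, |z i - x₀ i| ≤ (R : ℤ) + 1 :=
    fun y hy z hz => near_mono (near_trans hz hy) (by omega)
  have hinS : ∀ y : Site d, (∀ i, |y i - x₀ i| ≤ (R : ℤ)) → ∀ z : Site d, (∀ i, |z i - y i| ≤ 1) → ∀ i, |z i - c i| ≤ S :=
    fun y hy z hz => hfit z (near_mono (hnear y hy z hz) (by omega))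
  -- also points within `2` (for the Euler–Lagrange condition at `y + e_ν`, which reads `A` at `y + e_ν − e_κ`)
  have hb0 : 0 ≤ Real.exp a₀ - 1 := by linarith [Real.add_one_le_exp a₀]
  refine ⟨fun y hy ν => ?_, fun y hy ν => ?_⟩
  · -- (J)
    have hWexp' : ∀ z : Site d, (∀ i, |z i - y i| ≤ 1) → ∀ κ : Fin d, W z κ = expUnit (A z κ) := fun z hz => hWexp z (hinS y hy z hz)
    have hA' : ∀ z : Site d, (∀ i, |z i - y i| ≤ 1) → ∀ κ : Fin d, ‖A z κ‖ ≤ a₀ := fun z hz => hA z (hinS y hy z hz)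
    have hG' : ∀ z : Site d, (∀ i, |z i - y i| ≤ 1) → ∀ κ τ : Fin d, ‖A (z + e τ) κ - A z κ‖ ≤ G := fun z hz => hG z (hnear y hy z hz)
    refine norm_curlDiv_le_of_plaqDiv_local W A y ν hWexp' hA' hG' ?_
    have hWb : ∀ μ : Fin d, ‖((W (y - e μ) μ : (Matrix n n ℂ)ˣ) : (Matrix n n ℂ)) - 1‖ ≤ Real.exp a₀ - 1 ∧
        ‖(((W (y - e μ) μ)⁻¹ : (Matrix n n ℂ)ˣ) : (Matrix n n ℂ)) - 1‖ ≤ Real.exp a₀ - 1 := fun μ => by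
      rw [hWexp' (y - e μ) (near_sub_e y μ) μ]
      exact norm_expUnit_sub_one_le' (hA' (y - e μ) (near_sub_e y μ) μ)
    have h := norm_plaqDivFlat_le_covDiv_local W hε0 hb0 y ν hWb (fun μ κ κ' hne => ⟨hWε y κ κ' hne, hWε (y - e μ) κ κ' hne⟩)
    exact h.trans (add_le_add (hcov ν y) le_rfl)
  · -- (P): the reaction gradient of `div A` is within `2d(e^{a₀}−1)G` of that of `div sinh A`, which vanishes
    have hA' : ∀ z : Site d, (∀ i, |z i - y i| ≤ 1) → ∀ κ : Fin d, ‖A z κ‖ ≤ a₀ := fun z hz => hA z (hinS y hy z hz)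
    have hG' : ∀ z : Site d, (∀ i, |z i - y i| ≤ 1) → ∀ κ τ : Fin d, ‖A (z + e τ) κ - A z κ‖ ≤ G := fun z hz => hG z (hnear y hy z hz)
    have h1 := norm_dDiv_sub_dDiv_sinh_le_local A y ν hA' hG'
    have hy0 : ∀ i, |y i - c i| ≤ S := hinS y hy y (near_self y)
    have hyν : ∀ i, |(y + e ν) i - c i| ≤ S := hinS y hy (y + e ν) (near_add_e y ν)
    have hE1 := hEL (y + e ν) hyν
    have hE0 := hEL y hy0
    have hzero : (∑ μ, (((2 : ℂ)⁻¹ • (exp (A (y + e ν) μ) - exp (-A (y + e ν) μ)))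
                - ((2 : ℂ)⁻¹ • (exp (A (y + e ν - e μ) μ) - exp (-A (y + e ν - e μ) μ))))
          - ∑ μ, (((2 : ℂ)⁻¹ • (exp (A y μ) - exp (-A y μ))) - ((2 : ℂ)⁻¹ • (exp (A (y - e μ) μ) - exp (-A (y - e μ) μ))))) = 0 := by
      rw [hE1, hE0, sub_self]
    rw [hzero, sub_zero] at h1
    exact h1

/-- **THE CONDITIONAL LOCAL GRADIENT LETTER** (the input shape of G2 `NE7WeightedGradientBootstrap`): in the setting of `local_curl_div_bounds`, for `R ≥ 1`:
`‖A(x₀+e_τ)_κ − A(x₀)_κ‖ ≤ 2·(d·a₀∕R + R·((j + d(ε·b₀(2+b₀) + 2ε²(2+ε)) + 4d(e^{4a₀}−1)G) + 2d(e^{a₀}−1)G))` — (156)'s local interior letter fed with (J) and (P).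
[folklore] -/
theorem local_gradient_letter (hε0 : 0 ≤ ε) (ha₀0 : 0 ≤ a₀) (hWε : SmallField W ε) (hcov : ∀ (ν : Fin d) (z : Site d), ‖covDiv 1 W ν z‖ ≤ j)
    (hWexp : ∀ z : Site d, (∀ i, |z i - c i| ≤ S) → ∀ κ : Fin d, W z κ = expUnit (A z κ))
    (hA : ∀ z : Site d, (∀ i, |z i - c i| ≤ S) → ∀ κ : Fin d, ‖A z κ‖ ≤ a₀)
    (hEL : ∀ z : Site d, (∀ i, |z i - c i| ≤ S) →
      ∑ κ : Fin d, (((2 : ℂ)⁻¹ • (exp (A z κ) - exp (-A z κ))) - ((2 : ℂ)⁻¹ • (exp (A (z - e κ) κ) - exp (-A (z - e κ) κ)))) = 0)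
    (x₀ : Site d) {R : ℕ} (hR : 1 ≤ R) (hfit : ∀ y : Site d, (∀ i, |y i - x₀ i| ≤ (R : ℤ) + 3) → ∀ i, |y i - c i| ≤ S)
    {G : ℝ} (hG : ∀ y : Site d, (∀ i, |y i - x₀ i| ≤ (R : ℤ) + 1) → ∀ κ τ : Fin d, ‖A (y + e τ) κ - A y κ‖ ≤ G) (κ τ : Fin d) :
    ‖A (x₀ + e τ) κ - A x₀ κ‖ ≤ 2 * ((d : ℝ) * a₀ / R
      + R * (((j + d * (ε * (Real.exp a₀ - 1) * (2 + (Real.exp a₀ - 1)) + 2 * ε * ε * (2 + ε))) + 4 * d * (Real.exp (4 * a₀) - 1) * G)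
        + 2 * d * (Real.exp a₀ - 1) * G)) := by
  obtain ⟨hJ, hP⟩ := local_curl_div_bounds W A c S hε0 ha₀0 hWε hcov hWexp hA hEL x₀ R hfit hG
  have hU : ∀ y : Site d, (∀ i, |y i - x₀ i| ≤ (R : ℤ)) → ‖A y κ‖ ≤ a₀ :=
    fun y hy => hA y (hfit y (near_mono hy (by omega))) κ
  exact norm_fdiff_le_of_curl_div A x₀ κ τ hR hU (fun y hy => hJ y hy κ) (fun y hy => hP y hy κ)

/-- **THE CONDITIONAL LOCAL LAPLACIAN LETTER** (the (10)-type letter on a cube): in the setting of `local_curl_div_bounds`, at every `y` with `|y − x₀|_∞ ≤ R` and every `ν`: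
`‖Σ_i [(A(y+e_i)_ν − A(y)_ν) − (A(y)_ν − A(y−e_i)_ν)]‖ ≤ (j + d(ε·b₀(2+b₀) + 2ε²(2+ε)) + 4d(e^{4a₀}−1)G) + 2d(e^{a₀}−1)G` ((156) §1: `ΔA_ν = δ(dA)_ν + d(δA)_ν`). [folklore] -/
theorem local_laplacian_letter (hε0 : 0 ≤ ε) (ha₀0 : 0 ≤ a₀) (hWε : SmallField W ε) (hcov : ∀ (ν : Fin d) (z : Site d), ‖covDiv 1 W ν z‖ ≤ j)
    (hWexp : ∀ z : Site d, (∀ i, |z i - c i| ≤ S) → ∀ κ : Fin d, W z κ = expUnit (A z κ))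
    (hA : ∀ z : Site d, (∀ i, |z i - c i| ≤ S) → ∀ κ : Fin d, ‖A z κ‖ ≤ a₀)
    (hEL : ∀ z : Site d, (∀ i, |z i - c i| ≤ S) →
      ∑ κ : Fin d, (((2 : ℂ)⁻¹ • (exp (A z κ) - exp (-A z κ))) - ((2 : ℂ)⁻¹ • (exp (A (z - e κ) κ) - exp (-A (z - e κ) κ)))) = 0)
    (x₀ : Site d) (R : ℕ) (hfit : ∀ y : Site d, (∀ i, |y i - x₀ i| ≤ (R : ℤ) + 3) → ∀ i, |y i - c i| ≤ S)
    {G : ℝ} (hG : ∀ y : Site d, (∀ i, |y i - x₀ i| ≤ (R : ℤ) + 1) → ∀ κ τ : Fin d, ‖A (y + e τ) κ - A y κ‖ ≤ G)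
    (y : Site d) (hy : ∀ i, |y i - x₀ i| ≤ (R : ℤ)) (ν : Fin d) :
    ‖∑ i, ((A (y + e i) ν - A y ν) - (A y ν - A (y - e i) ν))‖
      ≤ ((j + d * (ε * (Real.exp a₀ - 1) * (2 + (Real.exp a₀ - 1)) + 2 * ε * ε * (2 + ε))) + 4 * d * (Real.exp (4 * a₀) - 1) * G)
        + 2 * d * (Real.exp a₀ - 1) * G := by
  obtain ⟨hJ, hP⟩ := local_curl_div_bounds W A c S hε0 ha₀0 hWε hcov hWexp hA hEL x₀ R hfit hG
  rw [laplacian_eq_sum_dCurl_add_dDiv A y ν]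
  exact (norm_add_le _ _).trans (add_le_add (hJ y hy ν) (hP y hy ν))

end Local

end

end Summit.QuantumFields.BalabanUV.T4Continuum.NE7LocalLandauGradientLetter
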